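import Summits.Ventures.PercRepro.C026GluingHA

/-!
# The H-graph of a 3-terminal gluing, part B: `o1`, `o2` and `BAD` split by colour (p6, gen 8)

mine-3's composition theorem, lemmas (L4)–(L5) of the statement sheet (`proofs/MINE3-Q3-proof.md`
§26.9), on the step transfer of `C026GluingHA.lean`:

* **(L4)** `hO1_gluing_iff`, `hO2_gluing_iff`: `o1(G) ⟺ o1(G₁) ∨ o1(G₀)`;
* **(L5)** `hBad_gluing_iff`: `BAD(G) ⟺ BAD(G₁) ∨ BAD(G₀) ∨ (o1(G) ∧ o2(G))`.

The paper's «first `L`-vertex / last `K`-vertex / first and last `c`» surgery on walks is replaced by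
invariants over `Relation.ReflTransGen`: a walk of `G` is followed step by step and restarted at the
marks `a`, `b`, `c` — the only vertices where the colour can change (`hasCol_of_hConn_part`).
-/

namespace PercRepro

namespace MultiGraph

section GluingH

variable {V E : Type*} {G : MultiGraph V E} {a b c : V} {side : E → Bool} {ω : Config E}

/-! ### (L4) `o1` splits by colour -/

/-- **(L4, ⇐)** `o1` of a part is `o1` of `G`: the part's walk avoiding `L_s` is a walk of `G`
avoiding `L` (its vertices other than `c` have the part's colour, so they are outside the other
part's cluster of `b`). -/
theorem hO1_of_part (hg : G.IsGluing a b c side) (hb : G.IsBot ω a b c) (hbc : b ≠ c) {s : Bool}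
    (h : (G.part side s).HO1 (sideRestrict ω side s) a b c) : G.HO1 ω a b c := by
  unfold HO1 at h ⊢
  suffices key : ∀ y, (G.part side s).HConnAvoid (sideRestrict ω side s) c
      ((G.part side s).cluster (sideRestrict ω side s) b) c y →
      G.HConnAvoid ω c (G.cluster ω b) c y ∧ y ∉ G.cluster ω b from (key a h).1
  intro y hy
  unfold HConnAvoid at hy ⊢
  induction hy with
  | refl =>
    exact ⟨Relation.ReflTransGen.refl,
      hb.not_mem_cluster_mark (Or.inr (Or.inl rfl)) (Or.inr (Or.inr rfl)) hbc⟩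
  | @tail x y _ hxy ih =>
    obtain ⟨hadj, _, hys⟩ := hxy
    obtain ⟨hwalk, hxL⟩ := ih
    have hyL : y ∉ G.cluster ω b := by
      by_cases hyx : y = x
      · subst hyx
        exact hxL
      · exact not_mem_cluster_of_hasCol hg hb (Or.inr (Or.inl rfl))
          (hasCol_of_hAdj_part hadj hyx) hys
    refine ⟨?_, hyL⟩
    rcases hAdj_of_part hg hb hadj with hxy | hxy
    · subst hxy
      exact hwalk
    · exact hwalk.tail ⟨hxy, hxL, hyL⟩

/-- **(L4, ⇒)** `o1` of `G` is `o1` of one part.  Invariant along the walk of `G` from `c` avoiding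
`L`: either some part already has `o1`, or the current vertex is reached from `c` by a walk of ONE
part avoiding that part's `L_s`; the walk restarts at `c`, and entering `K` finishes in one step. -/
theorem hO1_gluing_imp (hg : G.IsGluing a b c side) (hb : G.IsBot ω a b c) (hab : a ≠ b)
    (hac : a ≠ c) (hbc : b ≠ c) (h : G.HO1 ω a b c) :
    ∃ s, (G.part side s).HO1 (sideRestrict ω side s) a b c := by
  unfold HO1 at h
  have haL : a ∉ G.cluster ω b := hb.not_mem_cluster_mark (Or.inr (Or.inl rfl)) (Or.inl rfl) hab.symm
  have hcL : c ∉ G.cluster ω b :=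
    hb.not_mem_cluster_mark (Or.inr (Or.inl rfl)) (Or.inr (Or.inr rfl)) hbc
  have haM : a ∉ G.cluster ω c := hb.not_mem_cluster_mark (Or.inr (Or.inr rfl)) (Or.inl rfl) hac.symm
  suffices key : ∀ y, G.HConnAvoid ω c (G.cluster ω b) c y →
      (∃ s, (G.part side s).HO1 (sideRestrict ω side s) a b c) ∨
        ∃ s, (G.part side s).HConnAvoid (sideRestrict ω side s) c
          ((G.part side s).cluster (sideRestrict ω side s) b) c y by
    rcases key a h with h' | h'
    · exact h'
    · exact h'
  intro y hy
  unfold HConnAvoid at hy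
  induction hy with
  | refl => exact Or.inr ⟨true, Relation.ReflTransGen.refl⟩
  | @tail v w _ hvw ih =>
    obtain ⟨hadj, hvL, hwL⟩ := hvw
    rcases ih with done | ⟨s, walk⟩
    · exact Or.inl done
    have hvLs : v ∉ (G.part side s).cluster (sideRestrict ω side s) b :=
      not_mem_cluster_part_of_not_mem hvL
    have hwLs : ∀ s', w ∉ (G.part side s').cluster (sideRestrict ω side s') b :=
      fun _ => not_mem_cluster_part_of_not_mem hwL
    have haLs : ∀ s', a ∉ (G.part side s').cluster (sideRestrict ω side s') b :=
      fun _ => not_mem_cluster_part_of_not_mem haL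
    have hcLs : ∀ s', c ∉ (G.part side s').cluster (sideRestrict ω side s') b :=
      fun _ => not_mem_cluster_part_of_not_mem hcL
    by_cases hva : v = a
    · subst v
      exact Or.inl ⟨s, walk⟩
    by_cases hwc : w = c
    · subst w
      exact Or.inr ⟨true, Relation.ReflTransGen.refl⟩
    by_cases hvc : v = c
    · -- restart at `c` with the colour of the first edge
      subst v
      obtain ⟨s', hstep⟩ := hAdj_part_of_hAdj_c hg hb hadj
      by_cases hwK : w ∈ G.cluster ω a
      · -- `c → w → a` in the part of colour `s'`
        have hwM : w ∉ G.cluster ω c :=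
          fun h => hb.not_mem_both (Or.inl rfl) (Or.inr (Or.inr rfl)) hac hwK h
        have hwKs : w ∈ (G.part side s').cluster (sideRestrict ω side s') a :=
          mem_cluster_part_of_hasCol hg hb (Or.inl rfl) (hasCol_of_hAdj_part hstep hwc) hwK
        refine Or.inl ⟨s', (Relation.ReflTransGen.single ⟨hstep, hcLs s', hwLs s'⟩).tail
          ⟨hAdj_part_of_conn_part (not_mem_cluster_part_of_not_mem hwM)
            (not_mem_cluster_part_of_not_mem haM) (hwKs : _).symm, hwLs s', haLs s'⟩⟩
      · exact Or.inr ⟨s', Relation.ReflTransGen.single ⟨hstep, hcLs s', hwLs s'⟩⟩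
    -- `v` is a non-mark of colour `s`
    have hvb : v ≠ b := fun h => hvL (h ▸ Conn.refl _ _ _)
    have hcv : G.HasCol side s v := hasCol_of_hConnAvoid_part walk hvc
    by_cases hwK : w ∈ G.cluster ω a
    · -- entering `K`: finish in the part of colour `s`
      have hwM : w ∉ G.cluster ω c :=
        fun h => hb.not_mem_both (Or.inl rfl) (Or.inr (Or.inr rfl)) hac hwK h
      rcases hadj with ⟨_, hwM', _⟩ | ⟨hiff, e, hj⟩ | ⟨hvM, _, hconn⟩
      · exact absurd hwM' hwM
      · have hs : side e = s :=
          hg.eq_of_hasCol hva hvb hvc (HasCol.of_joins (side := side) hj).1 hcv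
        subst hs
        have hstep := hAdj_part_of_cross hg hb rfl hiff hj
        have hwKs : w ∈ (G.part side (side e)).cluster (sideRestrict ω side (side e)) a :=
          mem_cluster_part_of_hasCol hg hb (Or.inl rfl) (HasCol.of_joins (side := side) hj).2 hwK
        exact Or.inl ⟨side e, (walk.tail ⟨hstep, hvLs, hwLs _⟩).tail
          ⟨hAdj_part_of_conn_part (not_mem_cluster_part_of_not_mem hwM)
            (not_mem_cluster_part_of_not_mem haM) (hwKs : _).symm, hwLs _, haLs _⟩⟩
      · have hvK : v ∈ G.cluster ω a := (hwK : G.Conn ω a w).trans hconn.symm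
        have hvKs : v ∈ (G.part side s).cluster (sideRestrict ω side s) a :=
          mem_cluster_part_of_hasCol hg hb (Or.inl rfl) hcv hvK
        exact Or.inl ⟨s, walk.tail ⟨hAdj_part_of_conn_part (not_mem_cluster_part_of_not_mem hvM)
          (not_mem_cluster_part_of_not_mem haM) (hvKs : _).symm, hvLs, haLs s⟩⟩
    · -- outside `K`, `L` and `c`: the step stays in the part of colour `s`
      rcases hAdj_part_of_hAdj hg hb hcv hva hvb hvc hvL hwK hadj with hvw | hstep
      · subst hvw
        exact Or.inr ⟨s, walk⟩
      · exact Or.inr ⟨s, walk.tail ⟨hstep, hvLs, hwLs s⟩⟩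

/-- **(L4)** `o1(G) ⟺ o1(G₁) ∨ o1(G₀)`. -/
theorem hO1_gluing_iff (hg : G.IsGluing a b c side) (hb : G.IsBot ω a b c) (hab : a ≠ b)
    (hac : a ≠ c) (hbc : b ≠ c) :
    G.HO1 ω a b c ↔
      (G.part side true).HO1 (sideRestrict ω side true) a b c ∨
        (G.part side false).HO1 (sideRestrict ω side false) a b c := by
  constructor
  · intro h
    obtain ⟨s, hs⟩ := hO1_gluing_imp hg hb hab hac hbc h
    cases s
    · exact Or.inr hs
    · exact Or.inl hs
  · rintro (h | h)
    · exact hO1_of_part hg hb hbc h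
    · exact hO1_of_part hg hb hbc h

/-- **(L4)** `o2(G) ⟺ o2(G₁) ∨ o2(G₀)` (by the `a ↔ b` symmetry). -/
theorem hO2_gluing_iff (hg : G.IsGluing a b c side) (hb : G.IsBot ω a b c) (hab : a ≠ b)
    (hac : a ≠ c) (hbc : b ≠ c) :
    G.HO2 ω a b c ↔
      (G.part side true).HO2 (sideRestrict ω side true) a b c ∨
        (G.part side false).HO2 (sideRestrict ω side false) a b c :=
  hO1_gluing_iff hg.swap_ab hb.swap_ab hab.symm hbc hac

/-! ### (L5) `BAD` splits by colour -/

/-- **(L5, ⇐)** `BAD` of a part is `BAD` of `G`. -/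
theorem hBad_of_part (hg : G.IsGluing a b c side) (hb : G.IsBot ω a b c) {s : Bool}
    (h : (G.part side s).HBad (sideRestrict ω side s) a b c) : G.HBad ω a b c := by
  unfold HBad HConn at h ⊢
  suffices key : ∀ y, Relation.ReflTransGen ((G.part side s).HAdj (sideRestrict ω side s) c) a y →
      Relation.ReflTransGen (G.HAdj ω c) a y from key b h
  intro y hy
  induction hy with
  | refl => exact Relation.ReflTransGen.refl
  | tail _ hxy ih =>
    rcases hAdj_of_part hg hb hxy with hxy | hxy
    · subst hxy
      exact ih
    · exact ih.tail hxy

/-- The step of the (L5) invariant in the state «past `c`, avoiding `K`»: the walk either enters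
`L` (then `o2` holds, with `o1` already in hand), re-enters `K` (restart at `a`), or goes on. -/
theorem hBad_step_avoidK (hg : G.IsGluing a b c side) (hb : G.IsBot ω a b c) (hab : a ≠ b)
    (hac : a ≠ c) (hbc : b ≠ c) (ho1 : G.HO1 ω a b c) {v w : V}
    (walk : G.HConnAvoid ω c (G.cluster ω a) c v) (hvw : G.HAdj ω c v w) :
    (G.HO1 ω a b c ∧ G.HO2 ω a b c) ∨
      (∃ s, (G.part side s).HConnAvoid (sideRestrict ω side s) c
        ((G.part side s).cluster (sideRestrict ω side s) b) a w) ∨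
      (G.HO1 ω a b c ∧ G.HConnAvoid ω c (G.cluster ω a) c w) := by
  have hcK : c ∉ G.cluster ω a := hb.not_mem_cluster_mark (Or.inl rfl) (Or.inr (Or.inr rfl)) hac
  have hbK : b ∉ G.cluster ω a := hb.not_mem_cluster_mark (Or.inl rfl) (Or.inr (Or.inl rfl)) hab
  have hbM : b ∉ G.cluster ω c :=
    hb.not_mem_cluster_mark (Or.inr (Or.inr rfl)) (Or.inr (Or.inl rfl)) hbc.symm
  have haM : a ∉ G.cluster ω c := hb.not_mem_cluster_mark (Or.inr (Or.inr rfl)) (Or.inl rfl) hac.symm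
  have haL : a ∉ G.cluster ω b := hb.not_mem_cluster_mark (Or.inr (Or.inl rfl)) (Or.inl rfl) hab.symm
  have hvK : v ∉ G.cluster ω a := by
    rcases HConnAvoid.notMem_or_eq walk with h | hvc
    · exact h
    · subst v
      exact hcK
  by_cases hwL : w ∈ G.cluster ω b
  · -- into `L`: `c → … → v → w → b` avoids `K`, so `o2`
    have hwK : w ∉ G.cluster ω a :=
      fun h => hb.not_mem_both (Or.inl rfl) (Or.inr (Or.inl rfl)) hab h hwL
    have hwM : w ∉ G.cluster ω c :=
      fun h => hb.not_mem_both (Or.inr (Or.inl rfl)) (Or.inr (Or.inr rfl)) hbc hwL h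
    refine Or.inl ⟨ho1, (walk.tail ⟨hvw, hvK, hwK⟩).tail
      ⟨Or.inr (Or.inr ⟨hwM, hbM, (hwL : G.Conn ω b w).symm⟩), hwK, hbK⟩⟩
  by_cases hwK : w ∈ G.cluster ω a
  · -- re-entering `K`: restart at `a` in the colour of `w`
    have hwM : w ∉ G.cluster ω c :=
      fun h => hb.not_mem_both (Or.inl rfl) (Or.inr (Or.inr rfl)) hac hwK h
    obtain ⟨s, hws⟩ := (conn_mark_iff hg hb (Or.inl rfl) w).mp hwK
    exact Or.inr (Or.inl ⟨s, Relation.ReflTransGen.single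
      ⟨hAdj_part_of_conn_part (not_mem_cluster_part_of_not_mem haM)
        (not_mem_cluster_part_of_not_mem hwM) hws, not_mem_cluster_part_of_not_mem haL,
        not_mem_cluster_part_of_not_mem hwL⟩⟩)
  · exact Or.inr (Or.inr ⟨ho1, walk.tail ⟨hvw, hvK, hwK⟩⟩)

/-- **(L5, ⇒)** `BAD` of `G` is `BAD` of a part or `o1 ∧ o2`.  Invariant along the H-walk of `G`
from `a`: some part has `BAD`; or `o1 ∧ o2`; or the current vertex is reached from `a` by a walk of
ONE part avoiding its `L_s`; or `o1` holds and the current vertex is reached from `c` by a walk of `G`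
avoiding `K`.  The walk restarts at `a` (entering `K`), switches state at `c`, and finishes on
entering `L`. -/
theorem hBad_gluing_imp (hg : G.IsGluing a b c side) (hb : G.IsBot ω a b c) (hab : a ≠ b)
    (hac : a ≠ c) (hbc : b ≠ c) (h : G.HBad ω a b c) :
    (∃ s, (G.part side s).HBad (sideRestrict ω side s) a b c) ∨
      (G.HO1 ω a b c ∧ G.HO2 ω a b c) := by
  unfold HBad HConn at h
  have haL : a ∉ G.cluster ω b := hb.not_mem_cluster_mark (Or.inr (Or.inl rfl)) (Or.inl rfl) hab.symm
  have hcL : c ∉ G.cluster ω b :=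
    hb.not_mem_cluster_mark (Or.inr (Or.inl rfl)) (Or.inr (Or.inr rfl)) hbc
  have haM : a ∉ G.cluster ω c := hb.not_mem_cluster_mark (Or.inr (Or.inr rfl)) (Or.inl rfl) hac.symm
  have hbM : b ∉ G.cluster ω c :=
    hb.not_mem_cluster_mark (Or.inr (Or.inr rfl)) (Or.inr (Or.inl rfl)) hbc.symm
  suffices key : ∀ y, Relation.ReflTransGen (G.HAdj ω c) a y →
      (∃ s, (G.part side s).HBad (sideRestrict ω side s) a b c) ∨
        (G.HO1 ω a b c ∧ G.HO2 ω a b c) ∨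
        (∃ s, (G.part side s).HConnAvoid (sideRestrict ω side s) c
          ((G.part side s).cluster (sideRestrict ω side s) b) a y) ∨
        (G.HO1 ω a b c ∧ G.HConnAvoid ω c (G.cluster ω a) c y) by
    rcases key b h with h1 | h2 | ⟨s, walk⟩ | ⟨ho1, ho2⟩
    · exact Or.inl h1
    · exact Or.inr h2
    · exfalso
      rcases HConnAvoid.notMem_or_eq walk with hbL | hba
      · exact hbL (Conn.refl _ _ _)
      · exact hab hba.symm
    · exact Or.inr ⟨ho1, ho2⟩
  intro y hy
  induction hy with
  | refl => exact Or.inr (Or.inr (Or.inl ⟨true, Relation.ReflTransGen.refl⟩))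
  | @tail v w _ hvw ih =>
    rcases ih with h1 | h2 | ⟨s, walk⟩ | ⟨ho1, walkK⟩
    · exact Or.inl h1
    · exact Or.inr (Or.inl h2)
    · -- state: a one-coloured walk from `a` avoiding `L_s`
      have haLs : ∀ s', a ∉ (G.part side s').cluster (sideRestrict ω side s') b :=
        fun _ => not_mem_cluster_part_of_not_mem haL
      have hcLs : ∀ s', c ∉ (G.part side s').cluster (sideRestrict ω side s') b :=
        fun _ => not_mem_cluster_part_of_not_mem hcL
      by_cases hvc : v = c
      · -- at `c`: `o1` is in hand, switch to the `K`-avoiding state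
        subst v
        have ho1 : G.HO1 ω a b c := hO1_of_part hg hb hbc (HConnAvoid.symm walk)
        rcases hBad_step_avoidK hg hb hab hac hbc ho1 Relation.ReflTransGen.refl hvw with
          h2 | h3 | h4
        · exact Or.inr (Or.inl h2)
        · exact Or.inr (Or.inr (Or.inl h3))
        · exact Or.inr (Or.inr (Or.inr h4))
      -- `v ≠ c`: first, `v ∉ L`
      have hvL : v ∉ G.cluster ω b := by
        by_cases hva : v = a
        · subst v
          exact haL
        · rcases HConnAvoid.notMem_or_eq walk with hvLs | hva'
          · exact not_mem_cluster_of_hasCol hg hb (Or.inr (Or.inl rfl))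
              (hasCol_of_hConnAvoid_part walk hva) hvLs
          · exact absurd hva' hva
      have hvLs : v ∉ (G.part side s).cluster (sideRestrict ω side s) b :=
        not_mem_cluster_part_of_not_mem hvL
      have hvb : v ≠ b := fun h => hvL (h ▸ Conn.refl _ _ _)
      by_cases hwL : w ∈ G.cluster ω b
      · -- into `L`: `BAD` of the part of colour `s`
        have hwM : w ∉ G.cluster ω c :=
          fun h => hb.not_mem_both (Or.inr (Or.inl rfl)) (Or.inr (Or.inr rfl)) hbc hwL h
        rcases hvw with ⟨_, hwM', _⟩ | ⟨hiff, e, hj⟩ | ⟨_, _, hconn⟩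
        · exact absurd hwM' hwM
        · have hvM : v ∈ G.cluster ω c := hiff.mpr hwM
          have hva : v ≠ a := fun h => haM (h ▸ hvM)
          have hs : side e = s :=
            hg.eq_of_hasCol hva hvb hvc (HasCol.of_joins (side := side) hj).1
              (hasCol_of_hConnAvoid_part walk hva)
          subst hs
          have hstep := hAdj_part_of_cross hg hb rfl hiff hj
          have hwLs : w ∈ (G.part side (side e)).cluster (sideRestrict ω side (side e)) b :=
            mem_cluster_part_of_hasCol hg hb (Or.inr (Or.inl rfl))
              (HasCol.of_joins (side := side) hj).2 hwL
          exact Or.inl ⟨side e, ((HConnAvoid.hConn walk).tail hstep).tail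
            (hAdj_part_of_conn_part (not_mem_cluster_part_of_not_mem hwM)
              (not_mem_cluster_part_of_not_mem hbM) (hwLs : _).symm)⟩
        · exact absurd ((hwL : G.Conn ω b w).trans hconn.symm) hvL
      by_cases hwK : w ∈ G.cluster ω a
      · -- into `K`: restart at `a`
        have hwM : w ∉ G.cluster ω c :=
          fun h => hb.not_mem_both (Or.inl rfl) (Or.inr (Or.inr rfl)) hac hwK h
        obtain ⟨s', hws⟩ := (conn_mark_iff hg hb (Or.inl rfl) w).mp hwK
        exact Or.inr (Or.inr (Or.inl ⟨s', Relation.ReflTransGen.single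
          ⟨hAdj_part_of_conn_part (not_mem_cluster_part_of_not_mem haM)
            (not_mem_cluster_part_of_not_mem hwM) hws, haLs s',
            not_mem_cluster_part_of_not_mem hwL⟩⟩))
      by_cases hva : v = a
      · -- a step out of `a` to a vertex outside `K`: restart in the colour of the edge
        subst v
        obtain ⟨s', hstep⟩ := hAdj_part_of_hAdj_a hb hg hac hwK hvw
        exact Or.inr (Or.inr (Or.inl ⟨s', Relation.ReflTransGen.single
          ⟨hstep, haLs s', not_mem_cluster_part_of_not_mem hwL⟩⟩))
      -- `v` is a non-mark of colour `s`
      have hcv : G.HasCol side s v := hasCol_of_hConnAvoid_part walk hva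
      rcases hAdj_part_of_hAdj hg hb hcv hva hvb hvc hvL hwK hvw with hvw' | hstep
      · subst hvw'
        exact Or.inr (Or.inr (Or.inl ⟨s, walk⟩))
      by_cases hwc : w = c
      · -- into `c`: `o1` from the extended walk, then the `K`-avoiding state at `c`
        subst w
        have ho1 : G.HO1 ω a b c :=
          hO1_of_part hg hb hbc (HConnAvoid.symm (walk.tail ⟨hstep, hvLs, hcLs s⟩))
        exact Or.inr (Or.inr (Or.inr ⟨ho1, Relation.ReflTransGen.refl⟩))
      · exact Or.inr (Or.inr (Or.inl ⟨s, walk.tail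
          ⟨hstep, hvLs, not_mem_cluster_part_of_not_mem hwL⟩⟩))
    · -- state: `o1` in hand, a walk of `G` from `c` avoiding `K`
      rcases hBad_step_avoidK hg hb hab hac hbc ho1 walkK hvw with h2 | h3 | h4
      · exact Or.inr (Or.inl h2)
      · exact Or.inr (Or.inr (Or.inl h3))
      · exact Or.inr (Or.inr (Or.inr h4))

/-- **(L5)** `BAD(G) ⟺ BAD(G₁) ∨ BAD(G₀) ∨ (o1(G) ∧ o2(G))`. -/
theorem hBad_gluing_iff (hg : G.IsGluing a b c side) (hb : G.IsBot ω a b c) (hab : a ≠ b)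
    (hac : a ≠ c) (hbc : b ≠ c) :
    G.HBad ω a b c ↔
      (G.part side true).HBad (sideRestrict ω side true) a b c ∨
        (G.part side false).HBad (sideRestrict ω side false) a b c ∨
          (G.HO1 ω a b c ∧ G.HO2 ω a b c) := by
  constructor
  · intro h
    rcases hBad_gluing_imp hg hb hab hac hbc h with ⟨s, hs⟩ | h2
    · cases s
      · exact Or.inr (Or.inl hs)
      · exact Or.inl hs
    · exact Or.inr (Or.inr h2)
  · rintro (h | h | ⟨h1, h2⟩)
    · exact hBad_of_part hg hb h
    · exact hBad_of_part hg hb h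
    · exact hBad_of_hO1_hO2 h1 h2

end GluingH

end MultiGraph

end PercRepro
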